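import Literature.Computability.AlgebraicComplexity.GroupTheoreticMatMul
import Summits.MatrixMultiplication.OmegaCensus.STPPDisjointPacking
import Mathlib.Algebra.Group.Pointwise.Finset.Basic
import Mathlib.Data.Finset.Card

/-!
# STPP size patterns: monotonicity and role symmetry (the two inference rules of the census certificates)

Cell `pub-omega`, STPP track (family b′), seat pub-omega-stpp-3. HONEST FRAMING: lottery ticket; floor =
certified bounds/negative ranges. This file proves NOTHING about `ω`; it puts into the kernel the two
inference rules on which the abelian STPP census certificates (census3x / stpp-2 "cores + covering",
`HOME/pub-omega-stpp-3/ENGINE-stpp3x.md` §8) rest when they conclude "pattern `P` is not realisable in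
`H`" from "a core `P'` that EMBEDS into (an S₃-image of) `P` is not realisable in `H`":

* (M) **monotonicity** — sub-families (`isSTPP_subfamily`) and subsets (`isSTPP_mono`) of an STPP family
  are STPP families; hence if `H` realises the size pattern `(aᵢ, bᵢ, cᵢ)_{i<N}` it realises every
  pattern `(a'ⱼ, b'ⱼ, c'ⱼ)_{j<N'}` with an injection `ι` of triples and `a'ⱼ ≤ a_{ιj}`, `b'ⱼ ≤ b_{ιj}`,
  `c'ⱼ ≤ c_{ιj}` (`exists_isSTPP_of_embedding`; contrapositive `not_exists_isSTPP_of_embedding`);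
* (S) **role symmetry** — with the cyclic rotation already in the tree (`stpp_rotate`), the reflection
  `(A, B, C) ↦ (−C, −B, −A)` (`isSTPP_neg_reverse`) generates the full symmetric group on the three
  coordinates of a size pattern (`exists_isSTPP_rotate`, `exists_isSTPP_reverse`).

All statements are for the tree's additive `IsSTPP` (CKSU 2005 Def. 5.1 in a finite or infinite abelian
group). References: H. Cohn, R. Kleinberg, B. Szegedy, C. Umans, *Group-theoretic algorithms for matrix
multiplication*, FOCS 2005, arXiv:math/0511460, Def. 5.1.
-/

namespace Summit.MatrixMultiplication.OmegaCensus

open Finset Pointwise Literature.Computability.AlgebraicComplexity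

variable {H : Type*} [AddCommGroup H] {N N' : ℕ} {A B C : Fin N → Finset H}

/-- **Subsets of an STPP family form an STPP family** (the defining condition of CKSU Def. 5.1 is a
universal statement over the sets). [cite: CohnKleinbergSzegedyUmans2005, Def. 5.1] -/
theorem isSTPP_mono (hS : IsSTPP A B C) {A' B' C' : Fin N → Finset H} (hA : ∀ i, A' i ⊆ A i)
    (hB : ∀ i, B' i ⊆ B i) (hC : ∀ i, C' i ⊆ C i) : IsSTPP A' B' C' :=
  fun i j k s hs s' hs' t ht t' ht' u hu u' hu' h0 =>
    hS i j k s (hA k hs) s' (hA i hs') t (hB i ht) t' (hB j ht') u (hC j hu) u' (hC k hu') h0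

/-- **Sub-families of an STPP family are STPP families**: re-indexing along an injection of the
index set (deleting triples) preserves CKSU Def. 5.1 (same statement as the tree's
`IsSTPP.comp_of_injective`, restated to keep this file's imports minimal).
[cite: CohnKleinbergSzegedyUmans2005, Def. 5.1] -/
theorem isSTPP_subfamily (hS : IsSTPP A B C) (ι : Fin N' → Fin N) (hι : Function.Injective ι) :
    IsSTPP (fun j => A (ι j)) (fun j => B (ι j)) (fun j => C (ι j)) := by
  intro i j k s hs s' hs' t ht t' ht' u hu u' hu' h0
  obtain ⟨h1, h2, h3, h4, h5⟩ := hS (ι i) (ι j) (ι k) s hs s' hs' t ht t' ht' u hu u' hu' h0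
  exact ⟨hι h1, hι h2, h3, h4, h5⟩

/-- **Reflection symmetry of the STPP in an abelian group**: if `(Aᵢ, Bᵢ, Cᵢ)` is an STPP family then
so is `(−Cᵢ, −Bᵢ, −Aᵢ)` (read the defining relation `(s' − s) + (t' − t) + (u' − u) = 0` backwards with
all six letters negated; the index triple `(i, j, k)` becomes `(j, i, k)`). Together with the cyclic
rotation `stpp_rotate` this generates all six permutations of the roles. [folklore] -/
theorem isSTPP_neg_reverse [DecidableEq H] (hS : IsSTPP A B C) :
    IsSTPP (fun i => -(C i)) (fun i => -(B i)) (fun i => -(A i)) := by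
  intro i j k s hs s' hs' t ht t' ht' u hu u' hu' h0
  simp only [Finset.mem_neg'] at hs hs' ht ht' hu hu'
  have e : (-u - -u') + (-t - -t') + (-s - -s') = (s' - s) + (t' - t) + (u' - u) := by abel
  obtain ⟨hji, hik, hS', hT, hV⟩ :=
    hS j i k (-u') hu' (-u) hu (-t') ht' (-t) ht (-s') hs' (-s) hs (by rw [e, h0])
  exact ⟨hji.symm, hji.trans hik, (neg_injective hV).symm, (neg_injective hT).symm,
    (neg_injective hS').symm⟩

/-- **Realisable size patterns are closed under the cyclic rotation of coordinates**: if `H` realises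
`(aᵢ, bᵢ, cᵢ)ᵢ` by an STPP family then it realises `(bᵢ, cᵢ, aᵢ)ᵢ` (by `stpp_rotate`). [folklore] -/
theorem exists_isSTPP_rotate (a b c : Fin N → ℕ)
    (h : ∃ A B C : Fin N → Finset H, IsSTPP A B C ∧
      ∀ i, (A i).card = a i ∧ (B i).card = b i ∧ (C i).card = c i) :
    ∃ A B C : Fin N → Finset H, IsSTPP A B C ∧
      ∀ i, (A i).card = b i ∧ (B i).card = c i ∧ (C i).card = a i := by
  obtain ⟨A, B, C, hS, hcard⟩ := h
  exact ⟨B, C, A, stpp_rotate hS, fun i => ⟨(hcard i).2.1, (hcard i).2.2, (hcard i).1⟩⟩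

/-- **Realisable size patterns are closed under reversal of coordinates**: if `H` realises
`(aᵢ, bᵢ, cᵢ)ᵢ` by an STPP family then it realises `(cᵢ, bᵢ, aᵢ)ᵢ` (by `isSTPP_neg_reverse`; negation
preserves cardinalities). With `exists_isSTPP_rotate` every permutation of the three coordinates,
applied to all triples at once, preserves realisability — the role symmetry used for canonical forms
and core containment in the census. [folklore] -/
theorem exists_isSTPP_reverse [DecidableEq H] (a b c : Fin N → ℕ)
    (h : ∃ A B C : Fin N → Finset H, IsSTPP A B C ∧
      ∀ i, (A i).card = a i ∧ (B i).card = b i ∧ (C i).card = c i) :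
    ∃ A B C : Fin N → Finset H, IsSTPP A B C ∧
      ∀ i, (A i).card = c i ∧ (B i).card = b i ∧ (C i).card = a i := by
  obtain ⟨A, B, C, hS, hcard⟩ := h
  refine ⟨fun i => -(C i), fun i => -(B i), fun i => -(A i), isSTPP_neg_reverse hS, fun i => ?_⟩
  simp only [Finset.card_neg]
  exact ⟨(hcard i).2.2, (hcard i).2.1, (hcard i).1⟩

/-- **Monotonicity of realisable size patterns** (the pruning rule "a pattern containing a core is
infeasible", stated positively): if `H` realises `(aᵢ, bᵢ, cᵢ)_{i<N}` and the pattern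
`(a'ⱼ, b'ⱼ, c'ⱼ)_{j<N'}` embeds into it — an injection `ι` of triples with `a'ⱼ ≤ a_{ιj}`,
`b'ⱼ ≤ b_{ιj}`, `c'ⱼ ≤ c_{ιj}` — then `H` realises `(a'ⱼ, b'ⱼ, c'ⱼ)ⱼ` (take the sub-family along `ι`
and subsets of the prescribed sizes). [folklore] -/
theorem exists_isSTPP_of_embedding (a b c : Fin N → ℕ) (a' b' c' : Fin N' → ℕ)
    (ι : Fin N' → Fin N) (hι : Function.Injective ι)
    (ha : ∀ j, a' j ≤ a (ι j)) (hb : ∀ j, b' j ≤ b (ι j)) (hc : ∀ j, c' j ≤ c (ι j))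
    (h : ∃ A B C : Fin N → Finset H, IsSTPP A B C ∧
      ∀ i, (A i).card = a i ∧ (B i).card = b i ∧ (C i).card = c i) :
    ∃ A B C : Fin N' → Finset H, IsSTPP A B C ∧
      ∀ j, (A j).card = a' j ∧ (B j).card = b' j ∧ (C j).card = c' j := by
  obtain ⟨A, B, C, hS, hcard⟩ := h
  have hsub := isSTPP_subfamily hS ι hι
  have eA : ∀ j, ∃ s, s ⊆ A (ι j) ∧ s.card = a' j := fun j => by
    obtain ⟨s, hs, hs'⟩ := Finset.exists_subset_card_eq ((ha j).trans (hcard (ι j)).1.ge)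
    exact ⟨s, hs, hs'⟩
  have eB : ∀ j, ∃ s, s ⊆ B (ι j) ∧ s.card = b' j := fun j => by
    obtain ⟨s, hs, hs'⟩ := Finset.exists_subset_card_eq ((hb j).trans (hcard (ι j)).2.1.ge)
    exact ⟨s, hs, hs'⟩
  have eC : ∀ j, ∃ s, s ⊆ C (ι j) ∧ s.card = c' j := fun j => by
    obtain ⟨s, hs, hs'⟩ := Finset.exists_subset_card_eq ((hc j).trans (hcard (ι j)).2.2.ge)
    exact ⟨s, hs, hs'⟩
  choose A' hA' using eA
  choose B' hB' using eB
  choose C' hC' using eC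
  exact ⟨A', B', C', isSTPP_mono hsub (fun j => (hA' j).1) (fun j => (hB' j).1) (fun j => (hC' j).1),
    fun j => ⟨(hA' j).2, (hB' j).2, (hC' j).2⟩⟩

/-- **Core containment, as used by the census certificates**: if a size pattern `(a'ⱼ, b'ⱼ, c'ⱼ)ⱼ` is
NOT realisable by any STPP family in `H` and it embeds (injection of triples, coordinatewise `≤`)
into `(aᵢ, bᵢ, cᵢ)ᵢ`, then `(aᵢ, bᵢ, cᵢ)ᵢ` is not realisable in `H` either (contrapositive of
`exists_isSTPP_of_embedding`; combine with `exists_isSTPP_rotate` / `exists_isSTPP_reverse` for the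
S₃-images of the core). [folklore] -/
theorem not_exists_isSTPP_of_embedding (a b c : Fin N → ℕ) (a' b' c' : Fin N' → ℕ)
    (ι : Fin N' → Fin N) (hι : Function.Injective ι)
    (ha : ∀ j, a' j ≤ a (ι j)) (hb : ∀ j, b' j ≤ b (ι j)) (hc : ∀ j, c' j ≤ c (ι j))
    (h' : ¬ ∃ A B C : Fin N' → Finset H, IsSTPP A B C ∧
      ∀ j, (A j).card = a' j ∧ (B j).card = b' j ∧ (C j).card = c' j) :
    ¬ ∃ A B C : Fin N → Finset H, IsSTPP A B C ∧
      ∀ i, (A i).card = a i ∧ (B i).card = b i ∧ (C i).card = c i :=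
  fun h => h' (exists_isSTPP_of_embedding a b c a' b' c' ι hι ha hb hc h)

end Summit.MatrixMultiplication.OmegaCensus
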